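import Summits.CriticalPhenomena.PercolationContinuityZ3.Theorems.PercNearOneGluingNoHeavyLowerTailSunflowerTBernT2PackCore
import HarnessLib

/-!
# `NoHeavyLowerTail` (crux stmt-CriticalPhenomena-4575), abstract sunflower cubic: T-BERN — the certificate for
# {hub, sub-dwarf pack, ONE NON-LEVERAGED RICH TIGHT PETAL, h-petal} families

Support file (seat `prim-ineq-prove-1` gen 65; `--supports stmt-CriticalPhenomena-4575`).  No `sorry`, no named facts.
Memo: run/shared/lean/prim/prim-ineq-prove-1/FINDING-REDUCTION-prove1-g65.md §3.

**`domOn_hub_packT_h`**: the `TBern` certificate `DomOn s b β V` for every admissible family {arbitrary petal `P`, sub-dwarf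
pack `Q` (`vv = β`, `m = u`; floors included), tight petal `r` (`m_r = u_r`) with `b·vv_r ≤ β·m_r` (non-leveraged; `vv_r > β`
allowed), h-petal `h` (`u_h = m_h = b`)} (`0 < b ≤ β ≤ 1`, `0 ≤ s ≤ 1`).  The proof is the sequential scheme of
`…SunflowerTBernHubPackH` with the pack `Q ∪ {r}` absorbed exactly (`zone_extend_flex`; `r` is a γ-heavy x-type petal), the
h-step ★ from `star_of_hc` with `gz = γ_D z_P z_r`, and (HC) for this state supplied by `hcT_of_hc` (`…SunflowerTBernT2PackCore`,
from `hc_pack` by affine interpolation in `z_r`).  This is the second of the two endgames of the reduction of `TBern` to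
irreducible floor-free families (memo §1): hub, pack, one "T2" petal below the diagonal and one h-petal.
-/

noncomputable section

namespace Summit.CriticalPhenomena.PercolationContinuityZ3.Theorems.SunflowerPartition

namespace SafeCalc

namespace LinkedCurrency

open Finset Polynomial

variable {ι : Type*}

/-- **The `TBern` certificate for every admissible {hub, sub-dwarf pack, non-leveraged rich tight petal, h-petal} family.**
Parameters `0 < b ≤ β ≤ 1`, `0 ≤ s ≤ 1`; the family on `insert h (insert r (insert P Q))` is admissible, the pack petals `j ∈ Q`
have `vv_j = β`, `m_j = u_j`, the petal `r` is tight (`m_r = u_r`) with `b·vv_r ≤ β·m_r`, the h-petal has `u_h = m_h = b`; `P` is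
arbitrary.  Then `DomOn s b β V (insert h (insert r (insert P Q))) u vv m`. [this work] -/
theorem domOn_hub_packT_h [DecidableEq ι] {s b β V : ℝ} (hb : 0 < b) (hbβ : b ≤ β) (hβ1 : β ≤ 1) (hs0 : 0 ≤ s)
    (hs1 : s ≤ 1) {Q : Finset ι} {P r h : ι} (hPQ : P ∉ Q) (hrQ : r ∉ Q) (hrP : r ≠ P) (hhQ : h ∉ Q) (hhP : h ≠ P)
    (hhr : h ≠ r) {u vv m : ι → ℝ} (hadm : AdmissibleOn s b β V (insert h (insert r (insert P Q))) u vv m)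
    (hpack : ∀ j ∈ Q, vv j = β ∧ m j = u j) (hr : m r = u r) (hrz : b * vv r ≤ β * m r) (huh : u h = b)
    (hmh : m h = b) : DomOn s b β V (insert h (insert r (insert P Q))) u vv m := by
  obtain ⟨hub, -, hvβ, -, hmb, hmu, hmv, hpu, hpv, hpg⟩ := hadm
  have hs' : 0 ≤ 1 - s := sub_nonneg.2 hs1
  have hβ : 0 < β := hb.trans_le hbβ
  have hA₀ : 0 < s + (1 - s) * b := by
    have : 0 ≤ s * (1 - b) := mul_nonneg hs0 (by linarith)
    nlinarith
  have ha₀ : 0 < (1 - s) * b + s * β := by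
    have : 0 ≤ s * (β - b) := mul_nonneg hs0 (sub_nonneg.2 hbβ)
    nlinarith
  have hA₀ne := hA₀.ne'
  have ha₀ne := ha₀.ne'
  have hbne := hb.ne'
  have hβne := hβ.ne'
  -- membership facts
  have hrt : r ∉ insert P Q := by rw [mem_insert, not_or]; exact ⟨hrP, hrQ⟩
  have hht : h ∉ insert r (insert P Q) := by
    rw [mem_insert, not_or, mem_insert, not_or]; exact ⟨hhr, hhP, hhQ⟩
  set T := insert h (insert r (insert P Q)) with hT
  have hP : P ∈ T := mem_insert_of_mem (mem_insert_of_mem (mem_insert_self P Q))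
  have hrr : r ∈ T := mem_insert_of_mem (mem_insert_self r _)
  have hhh : h ∈ T := mem_insert_self h _
  have hQ : ∀ j ∈ Q, j ∈ T := fun j hj => mem_insert_of_mem (mem_insert_of_mem (mem_insert_of_mem hj))
  have hcard : T.card = Q.card + 3 := by
    rw [hT, card_insert_of_notMem hht, card_insert_of_notMem hrt, card_insert_of_notMem hPQ]
  rw [hcard, show Q.card + 3 - 1 = Q.card + 2 by omega] at hpu hpv hpg
  rw [hT, prod_insert hht, prod_insert hrt, prod_insert hPQ] at hpu hpv hpg
  -- normalised parameters
  set A₀ := s + (1 - s) * b with hA₀d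
  set a₀ := (1 - s) * b + s * β with ha₀d
  set κ := (1 - s) * b / A₀ with hκ
  set lam := (1 - s) * b / a₀ with hlam
  set μ := s * β / a₀ with hμd
  set D := β / b with hDd
  set K := (1 - s) / A₀ with hKd
  have hκ0 : 0 ≤ κ := div_nonneg (mul_nonneg hs' hb.le) hA₀.le
  have hκl : κ ≤ lam := by
    rw [hκ, hlam]
    refine div_le_div_of_nonneg_left (mul_nonneg hs' hb.le) ha₀ ?_
    rw [ha₀d, hA₀d]; linarith [mul_le_mul_of_nonneg_left hβ1 hs0]
  have hl1 : lam ≤ 1 := by rw [hlam, div_le_one ha₀, ha₀d]; linarith [mul_nonneg hs0 hβ.le]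
  have hl0 : 0 ≤ lam := hκ0.trans hκl
  have hκ1 : κ ≤ 1 := hκl.trans hl1
  have hμ : μ = 1 - lam := norm_mu_eq ha₀ne
  have hμ0 : 0 ≤ μ := div_nonneg (mul_nonneg hs0 hβ.le) ha₀.le
  have hD : 1 ≤ D := by rw [hDd, one_le_div hb]; exact hbβ
  have hK0 : 0 ≤ K := div_nonneg hs' hA₀.le
  have habar : 1 / A₀ = (1 - κ) + K := norm_abar_eq hA₀ne
  have hγD : lam * D + μ = β / a₀ := norm_gammaD_eq hbne ha₀ne
  have hI : μ * (1 / A₀) = (1 - κ) * (lam * D + μ) := by rw [hγD]; exact norm_I_eq hA₀ne ha₀ne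
  have hγD0 : 0 < lam * D + μ := by rw [hγD]; exact div_pos hβ ha₀
  have hγD1 : 1 ≤ lam * D + μ := by rw [hμ]; linarith [mul_le_mul_of_nonneg_left hD hl0]
  -- normalised functions (the pack function ξ carries `w_r/z_r − 1` at `r`)
  set xf : ι → ℝ := fun j => u j / b with hxf
  set cf : ι → ℝ := fun j => ((1 - s) * m j + s * vv j) / a₀ with hcf
  set w := m r / b with hwdef
  set z := vv r / β with hzdef
  set ξ : ι → ℝ := fun j => if j = r then w / z - 1 else u j / b - 1 with hξ
  have hα : ∀ j, (s + (1 - s) * u j) / A₀ = 1 + κ * (xf j - 1) := fun j => norm_alpha_eq hbne hA₀ne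
  have hcf_eq : ∀ j, cf j = lam * (m j / b) + μ * (vv j / β) := fun j => norm_gamma_eq hbne hβne ha₀ne
  have hξQ : ∀ j ∈ Q, ξ j = u j / b - 1 := fun j hj => by
    have : j ≠ r := fun e => hrQ (e ▸ hj)
    simp only [hξ, this, if_false]
  have hξr : ξ r = w / z - 1 := by simp only [hξ, if_true]
  have hxξ : ∀ j ∈ Q, xf j = 1 + ξ j := fun j hj => by rw [hξQ j hj]; simp only [hxf]; ring
  -- pack data
  have hξ0Q : ∀ j ∈ Q, 0 ≤ ξ j := fun j hj => by
    have h1 : 1 ≤ u j / b := by rw [one_le_div hb]; exact hub j (hQ j hj)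
    rw [hξQ j hj]; linarith
  have hξDQ : ∀ j ∈ Q, ξ j ≤ D - 1 := fun j hj => by
    have h1 : u j ≤ β := by rw [← (hpack j hj).2, ← (hpack j hj).1]; exact hmv j (hQ j hj)
    have h2 : u j / b ≤ β / b := div_le_div_of_nonneg_right h1 hb.le
    rw [hξQ j hj, hDd]; linarith
  have hcfQ : ∀ j ∈ Q, cf j = 1 + lam * ξ j := fun j hj => by
    rw [hcf_eq, (hpack j hj).2, (hpack j hj).1, div_self hβne, hμ, hξQ j hj]; ring
  -- hub data
  have hxP1 : 1 ≤ u P / b := by rw [one_le_div hb]; exact hub P hP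
  have hz1 : 1 ≤ vv P / β := by rw [one_le_div hβ]; exact hvβ P hP
  have hw1 : 1 ≤ m P / b := by rw [one_le_div hb]; exact hmb P hP
  have hwx : m P / b ≤ u P / b := div_le_div_of_nonneg_right (hmu P hP) hb.le
  have hwD : m P / b ≤ D * (vv P / β) := by
    rw [hDd, div_mul_div_comm, div_le_div_iff₀ hb (mul_pos hb hβ)]
    have := mul_le_mul_of_nonneg_right (hmv P hP) (mul_pos hb hβ).le
    linarith
  have hγP : cf P = lam * (m P / b) + μ * (vv P / β) := hcf_eq P
  have hγP1 : 1 ≤ cf P := by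
    have h1 : lam * 1 ≤ lam * (m P / b) := mul_le_mul_of_nonneg_left hw1 hl0
    have h2 : μ * 1 ≤ μ * (vv P / β) := mul_le_mul_of_nonneg_left hz1 hμ0
    rw [hγP]; rw [hμ] at h2 ⊢; linarith
  have hγP0 : 0 < cf P := by linarith
  -- the petal `r`: `1 ≤ z ≤ w ≤ D z`
  have hw : 1 ≤ w := by rw [hwdef, one_le_div hb]; exact hmb r hrr
  have hzr1 : 1 ≤ z := by rw [hzdef, one_le_div hβ]; exact hvβ r hrr
  have hz0 : 0 < z := by linarith
  have hzw : z ≤ w := by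
    rw [hwdef, hzdef, div_le_div_iff₀ hβ hb]
    linarith
  have hwDz : w ≤ D * z := by
    rw [hwdef, hDd, hzdef, div_mul_div_comm, div_le_div_iff₀ hb (mul_pos hb hβ)]
    have := mul_le_mul_of_nonneg_right (hmv r hrr) (mul_pos hb hβ).le
    linarith
  have hξr0 : 0 ≤ ξ r := by rw [hξr, sub_nonneg, one_le_div hz0]; exact hzw
  have hξrD : ξ r ≤ D - 1 := by
    rw [hξr]; have : w / z ≤ D := by rw [div_le_iff₀ hz0]; exact hwDz
    linarith
  have hξ0 : ∀ j ∈ insert r Q, 0 ≤ ξ j := by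
    intro j hj; rcases mem_insert.1 hj with rfl | hj
    · exact hξr0
    · exact hξ0Q j hj
  have hξD : ∀ j ∈ insert r Q, ξ j ≤ D - 1 := by
    intro j hj; rcases mem_insert.1 hj with rfl | hj
    · exact hξrD
    · exact hξDQ j hj
  have hxr : xf r = w := by simp only [hxf, hwdef, hr]
  have hxr' : z * (1 + ξ r) = w := by rw [hξr]; field_simp; ring
  have hcr : cf r = lam * w + μ * z := by rw [hcf_eq]
  have hcr' : z * (1 + lam * ξ r) = cf r := by rw [hcr, hξr, hμ]; field_simp; ring
  have hαγr : 1 + κ * (w - 1) ≤ lam * w + μ * z := by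
    have h1 := alpha_le_gamma hκl hw
    have h3 := mul_nonneg hμ0 (sub_nonneg.2 hzr1)
    rw [hμ] at h3 ⊢; linarith
  have hcr0 : 0 ≤ cf r := by
    rw [hcr]; have := mul_nonneg hκ0 (sub_nonneg.2 hw); linarith
  -- h-petal data
  have hxh : xf h = 1 := by simp only [hxf, huh, div_self hbne]
  have hah : 1 + κ * (xf h - 1) = 1 := by rw [hxh]; ring
  have hζ0 : 0 ≤ vv h / β - 1 := by rw [sub_nonneg, one_le_div hβ]; exact hvβ h hhh
  have hch : cf h = 1 + μ * (vv h / β - 1) := by rw [hcf_eq, hmh, div_self hbne, hμ]; ring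
  have hch0 : 0 ≤ cf h := by rw [hch]; have := mul_nonneg hμ0 hζ0; linarith
  -- STEP A: hub singleton + flexible absorption of `insert r Q`
  have hbase : CoefDom (prodPoly {P} (fun j => 1 + κ * (xf j - 1)) cf)
      ((C 1 * X + C 1) ^ (({P} : Finset ι).card - 1) * (C (1 + κ * (u P / b - 1)) * X + C (cf P))) :=
    coefDom_prodPoly_singleton le_rfl le_rfl
  have hαP0 : 0 ≤ 1 + κ * (u P / b - 1) := by
    have := mul_nonneg hκ0 (sub_nonneg.2 hxP1); linarith
  have hWx : ∀ j ∈ insert r Q, 1 ≤ xf j := by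
    intro j hj; rcases mem_insert.1 hj with rfl | hj
    · rw [hxr]; exact hw
    · rw [hxξ j hj]; linarith [hξ0Q j hj]
  have hWγx : ∀ j ∈ insert r Q, cf j ≤ xf j := by
    intro j hj; rcases mem_insert.1 hj with rfl | hj
    · rw [hxr, hcr]
      have := mul_le_mul_of_nonneg_left hzw hμ0
      rw [hμ] at this ⊢; linarith
    · rw [hcfQ j hj, hxξ j hj]
      have := mul_le_mul_of_nonneg_right hl1 (hξ0Q j hj)
      linarith
  have hWg : ∀ j ∈ insert r Q, 1 + κ * (xf j - 1) ≤ cf j := by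
    intro j hj; rcases mem_insert.1 hj with rfl | hj
    · rw [hxr, hcr]; exact hαγr
    · rw [hcfQ j hj, hxξ j hj, add_sub_cancel_left]
      have := mul_le_mul_of_nonneg_right hκl (hξ0Q j hj)
      linarith
  have hdisjPW : Disjoint ({P} : Finset ι) (insert r Q) :=
    disjoint_singleton_left.2 (by rw [mem_insert, not_or]; exact ⟨hrP.symm, hPQ⟩)
  obtain ⟨A', hdomPW, hA'le, -, hdisj⟩ := zone_extend_flex (X₀ := u P / b) (A := 1 + κ * (u P / b - 1))
    (G := cf P) hκ0 hκ1 xf cf {P} (singleton_nonempty P) hxP1 hγP1 le_rfl hαP0 hbase (insert r Q)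
    hdisjPW hWx hWγx hWg
  have hsetPW : ({P} : Finset ι) ∪ insert r Q = insert r (insert P Q) := by
    rw [← insert_eq, Finset.insert_comm]
  rw [hsetPW] at hdomPW
  -- products over `insert r Q`
  rw [prod_insert hrQ] at hA'le hdisj hdomPW
  have hpackG : packG lam Q ξ = ∏ j ∈ Q, cf j := prod_congr rfl fun j hj => (hcfQ j hj).symm
  have hpackS : packS κ lam Q ξ = ∑ j ∈ Q, (cf j - (1 + κ * (xf j - 1))) / cf j := by
    refine sum_congr rfl fun j hj => ?_
    rw [hcfQ j hj, hxξ j hj, add_sub_cancel_left]; ring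
  have hprodX : ∏ j ∈ Q, (1 + ξ j) = ∏ j ∈ Q, xf j := prod_congr rfl fun j hj => (hxξ j hj).symm
  have hXQ1 : 1 ≤ ∏ j ∈ Q, xf j :=
    Pendant.one_le_prod_of_one_le Q fun j hj => by rw [hxξ j hj]; linarith [hξ0Q j hj]
  have hgQ1 : 1 ≤ ∏ j ∈ Q, cf j := by rw [← hpackG]; exact one_le_packG hl0 Q hξ0Q
  have hcr1 : 1 ≤ cf r := by
    rw [hcr]; have := mul_nonneg hκ0 (sub_nonneg.2 hw); linarith
  have hGW1 : 1 ≤ cf P * (cf r * ∏ j ∈ Q, cf j) :=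
    one_le_mul_of_one_le_of_one_le hγP1 (one_le_mul_of_one_le_of_one_le hcr1 hgQ1)
  -- BUDGETS.  u-budget (u_h = b): u_r u_P ∏_Q u ≤ b^(|Q|+1)
  rw [huh, pow_succ, mul_comm (b ^ (Q.card + 1)) b] at hpu
  have hubud : u r * (u P * ∏ j ∈ Q, u j) ≤ b ^ (Q.card + 1) := le_of_mul_le_mul_left hpu hb
  have hXprod : u P / b * w * ∏ j ∈ Q, xf j = (u r * (u P * ∏ j ∈ Q, u j)) / (b * b * b ^ Q.card) := by
    simp only [hxf]
    rw [hwdef, hr, prod_div_distrib, prod_const, div_mul_div_comm, div_mul_div_comm]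
    ring
  have hXle : u P / b * w * ∏ j ∈ Q, xf j ≤ 1 / b := by
    rw [hXprod, div_le_div_iff₀ (mul_pos (mul_pos hb hb) (pow_pos hb _)) hb]
    calc (u r * (u P * ∏ j ∈ Q, u j)) * b ≤ b ^ (Q.card + 1) * b := mul_le_mul_of_nonneg_right hubud hb.le
      _ = 1 * (b * b * b ^ Q.card) := by ring
  have hbud : κ * (u P / b * z) * ∏ j ∈ insert r Q, (1 + ξ j) ≤ K := by
    rw [prod_insert hrQ, hprodX]
    have e2 : κ * (u P / b * z) * ((1 + ξ r) * ∏ j ∈ Q, xf j) = κ * (u P / b * (z * (1 + ξ r)) * ∏ j ∈ Q, xf j) := by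
      ring
    rw [e2, hxr', hκ, hKd, div_mul_eq_mul_div, div_le_div_iff_of_pos_right hA₀]
    have h1 := mul_le_mul_of_nonneg_left hXle (mul_nonneg hs' hb.le)
    have e : (1 - s) * b * (1 / b) = 1 - s := by field_simp
    linarith
  have hαbud : 1 + κ * (u P / b * (w * ∏ j ∈ Q, xf j) - 1) ≤ 1 / A₀ := by
    rw [habar, hKd, hκ]
    have h1 : (1 - s) * b / A₀ * (u P / b * (w * ∏ j ∈ Q, xf j) - 1) ≤ (1 - s) * b / A₀ * (1 / b - 1) :=
      mul_le_mul_of_nonneg_left (by linarith [hXle]) hκ0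
    have e : (1 - s) * b / A₀ * (1 / b - 1) = (1 - s) / A₀ - (1 - s) * b / A₀ := by field_simp
    linarith
  have hA'abar : A' ≤ 1 / A₀ := by rw [hxr] at hA'le; exact hA'le.trans hαbud
  -- g-budget ⟹ G_W · cf h ≤ V/a₀
  have hgbud : cf P * (cf r * ∏ j ∈ Q, cf j) * cf h ≤ V / a₀ := by
    simp only [hcf]
    rw [prod_div_distrib, prod_const, div_mul_div_comm, div_mul_div_comm, div_mul_div_comm,
      div_le_div_iff₀ (mul_pos (mul_pos ha₀ (mul_pos ha₀ (pow_pos ha₀ _))) ha₀) ha₀]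
    calc ((1 - s) * m P + s * vv P) * (((1 - s) * m r + s * vv r) * ∏ j ∈ Q, ((1 - s) * m j + s * vv j)) *
          ((1 - s) * m h + s * vv h) * a₀
        = ((1 - s) * m h + s * vv h) * (((1 - s) * m r + s * vv r) *
            (((1 - s) * m P + s * vv P) * ∏ j ∈ Q, ((1 - s) * m j + s * vv j))) * a₀ := by ring
      _ ≤ a₀ ^ (Q.card + 2) * V * a₀ := mul_le_mul_of_nonneg_right hpg ha₀.le
      _ = V * (a₀ * (a₀ * a₀ ^ Q.card) * a₀) := by ring
  have hgbud' : cf P * (cf r * ∏ j ∈ Q, cf j) * (1 + μ * (vv h / β - 1)) ≤ V / a₀ := by rw [← hch]; exact hgbud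
  -- vv-budget ⟹ γ_D z_P z_r z_h ≤ V/a₀
  have hzbud : (lam * D + μ) * (vv P / β) * z * (1 + (vv h / β - 1)) ≤ V / a₀ := by
    rw [prod_congr rfl fun j hj => (hpack j hj).1, prod_const] at hpv
    have h1 : vv h * (vv r * vv P) ≤ β * β * V := by
      have h2 : vv h * (vv r * vv P) * β ^ Q.card ≤ β * β * V * β ^ Q.card := by
        have e1 : vv h * (vv r * vv P) * β ^ Q.card = vv h * (vv r * (vv P * β ^ Q.card)) := by ring
        have e2 : β * β * V * β ^ Q.card = β ^ (Q.card + 2) * V := by ring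
        rw [e1, e2]; exact hpv
      exact le_of_mul_le_mul_right h2 (pow_pos hβ _)
    have e3 : β / a₀ * (vv P / β) * (vv r / β) * (vv h / β) = (vv h * (vv r * vv P)) / (a₀ * (β * β)) := by
      field_simp
    rw [hγD, hzdef, add_sub_cancel, e3, div_le_div_iff₀ (mul_pos ha₀ (mul_pos hβ hβ)) ha₀]
    calc vv h * (vv r * vv P) * a₀ ≤ β * β * V * a₀ := mul_le_mul_of_nonneg_right h1 ha₀.le
      _ = V * (a₀ * (β * β)) := by ring
  -- STEP B: the h-petal (★ with gz = γ_D z_P z_r)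
  have hstar : A' * cf h + cf P * (cf r * ∏ j ∈ Q, cf j) ≤ 1 / A₀ + V / a₀ := by
    rw [hch]
    have hgz : 0 < (lam * D + μ) * (vv P / β) * z := mul_pos (mul_pos hγD0 (by linarith)) hz0
    have hIle : 1 / A₀ * μ ≤ (lam * D + μ) * (vv P / β) * z := by
      rw [mul_comm, hI]
      calc (1 - κ) * (lam * D + μ) ≤ 1 * (lam * D + μ) := mul_le_mul_of_nonneg_right (by linarith) hγD0.le
        _ = (lam * D + μ) * 1 * 1 := by ring
        _ ≤ (lam * D + μ) * (vv P / β) * z :=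
            mul_le_mul (mul_le_mul_of_nonneg_left hz1 hγD0.le) hzr1 zero_le_one
              (mul_nonneg hγD0.le (by linarith))
    refine star_of_hc hμ0 hζ0 hgz hA'abar hgbud' hzbud hIle ?_
    intro hrelG hrelA
    rcases hdisj with hleft | ⟨hA'eq, -⟩
    · exact absurd hrelA (not_lt.2 hleft)
    · -- the exact state: (HC) from `hcT_of_hc`
      rw [sum_insert hrQ] at hA'eq
      have hGeq : cf P * (cf r * ∏ j ∈ Q, cf j) = (lam * (m P / b) + μ * (vv P / β)) * packG lam Q ξ *
          (z * (1 + lam * ξ r)) := by rw [hpackG, hγP, hcr']; ring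
      have hAeq : A' = cf P * (cf r * ∏ j ∈ Q, cf j) * ((1 + κ * (u P / b - 1)) / (lam * (m P / b) + μ * (vv P / β)) -
          packS κ lam Q ξ - (z * (1 + lam * ξ r) - (1 + κ * (z * (1 + ξ r) - 1))) / (z * (1 + lam * ξ r))) := by
        rw [hA'eq, hpackS, hcr', hxr', ← hγP, hxr]; ring
      exact hcT_of_hc hκ0 hκl hl1 hμ hD hK0 habar hI Q hrQ hξ0 hξD hz1 hw1 hwx hwD hzr1 hbud hGeq hAeq hrelG hrelA
  have hfull := coefDom_insert_h_of_star (a := fun j => 1 + κ * (xf j - 1)) (c := cf)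
    (insert_nonempty r (insert P Q)) hht hdomPW hah hch0 hA'abar hgbud hstar
  -- STEP C: back to `DomOn`
  refine domOn_of_normalised hA₀ ha₀ ⟨h, hhh⟩ ?_
  have e1 : (fun j => (s + (1 - s) * u j) / A₀) = fun j => 1 + κ * (xf j - 1) := funext hα
  rw [e1]
  exact hfull

end LinkedCurrency

end SafeCalc

end Summit.CriticalPhenomena.PercolationContinuityZ3.Theorems.SunflowerPartition
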